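import Literature.Computability.AlgebraicComplexity.KV20NonRigidEquationsProofs
import Literature.Computability.AlgebraicComplexity.KV20LinearCircuitEquations
import HarnessLib

/-!
# Kumar–Volk 2020/2022, §5: Theorem 5.5 and Theorem 1.4 (equations for tensors of small rank) —
# PROOFS of the typed facts `kumarVolk2020_thm_5_5`, `kumarVolk2020_thm_1_4`

Topic: `Literature/Computability/AlgebraicComplexity`. Source: M. Kumar, B. L. Volk, ACM TOCT 14(2)
(2022) art. 6 = arXiv:2003.12938 [KumarVolk2022], §5 (journal numbering, as in the statement file
`KV20LinearCircuitEquations.lean`, typer x5). Theorem-only file.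

## The printed proofs and their rendering

* **Thm 5.5** ([s2 p0016]): "We now argue that for `r = n²/300`, the image of the polynomial map
  `P` given by Lemma 5.4 has an equation of not too large degree. [Lemma 2.1 with `N = n³`, `D = 3`,
  `K = 3nr = n³/100`, `Δ = n⁴`:] `binom(n³+n⁴, n³) ≥ n^{n³}`, whereas
  `binom(n³/100 + 3n⁴, n³/100) ≤ (2n⁴)^{n³/100}`". Rendered with Lemma 5.4 PROVED in the statement
  file (`kumarVolk2020_lem_5_4_holds`), the dimension count `KumarVolk2020.exists_isEquationFor_polyMapImage`
  (Lemma 2.1, file `KV20NonRigidEquationsProofs.lean`) and the exact elementary chain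
  `binom(K+3n⁴, K) ≤ (3n⁴+1)^K ≤ (n+1)^{5K} < (n+1)^{n³} ≤ binom(n⁴+n³, n³)` (`5K < n³` since
  `K = 3n⌊n²/300⌋ ≤ n³/100`), valid for every `n ≥ 1` (`KumarVolk2020.choose_lt_choose_of_pow`).
* **Thm 1.4** ([s2 p0016]): "Setting `r = n^{d-1}/(100d)` and combining [Lemma 5.6] with a dimension
  comparison argument analogous to that in the proof of Theorem 5.5 gives Theorem 1.4. We skip the
  details of the proof." Details supplied here: Lemma 5.6 (`kumarVolk2020_lem_5_6_holds`, statement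
  file) with `K = dnr ≤ n^d/100`, `D = d`, `N = n^d`, `Δ = n^{2d}`, and the chain
  `binom(K + d n^{2d}, K) ≤ (d n^{2d}+1)^K ≤ (n^d+1)^{3K} < (n^d+1)^{n^d} ≤ binom(n^{2d}+n^d, n^d)`
  (using `d ≤ n^d`, which holds as soon as `K ≥ 1` forces `n ≥ 2`; the corner `K = 0` is
  `1 < binom`).

Honest framing (val-lit): discharges of published, proved statements; nothing here bears on
`VP ≠ VNP`.

## References

* [KumarVolk2022] doi:10.1145/3543685, arXiv:2003.12938 — Thm 5.5, Lemma 5.6, Thm 1.4 (§5).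
-/

noncomputable section

open MvPolynomial

namespace Literature.Computability.AlgebraicComplexity

namespace KumarVolk2020

/-! ### The counts -/

/-- The generic count behind Theorems 1.1, 5.5 and 1.4: if `M + 1 ≤ (β+1)^e`, `eK < N`, `β ≥ 1` and
`βN ≤ m`, then `binom(K + M, K) < binom(m + N, N)`
(`binom(K+M,K) ≤ (M+1)^K ≤ (β+1)^{eK} < (β+1)^N ≤ binom(m+N,N)`). [cite: KumarVolk2022, Thm. 5.5 (proof)] -/
theorem choose_lt_choose_of_pow {K M N m β e : ℕ} (hM : M + 1 ≤ (β + 1) ^ e) (hK : e * K < N)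
    (hβ : 1 ≤ β) (hm : β * N ≤ m) : (K + M).choose K < (m + N).choose N :=
  calc (K + M).choose K ≤ (M + 1) ^ K := choose_add_le_succ_pow K M
    _ ≤ ((β + 1) ^ e) ^ K := Nat.pow_le_pow_left hM K
    _ = (β + 1) ^ (e * K) := by rw [← pow_mul]
    _ < (β + 1) ^ N := Nat.pow_lt_pow_right (by omega) hK
    _ ≤ (m + N).choose N := succ_pow_le_choose β N m hm

/-- `(b + 1)^3 ≥ b^3 + 1`, `(b+1)^5 ≥ 5 b^4 + 1`-type bounds: `c · b^k + 1 ≤ (b+1)^(k+1)` whenever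
`c ≤ b` … here only the two instances used. [cite: KumarVolk2022, Thm. 5.5 (proof)] -/
theorem three_mul_pow_four_succ_le (n : ℕ) : 3 * n ^ 4 + 1 ≤ (n + 1) ^ 5 := by
  have h : (n + 1) ^ 5 = n ^ 5 + 5 * n ^ 4 + 10 * n ^ 3 + 10 * n ^ 2 + 5 * n + 1 := by ring
  rw [h]
  have : 3 * n ^ 4 ≤ 5 * n ^ 4 := Nat.mul_le_mul_right _ (by norm_num)
  omega

/-- `d · N² + 1 ≤ (N + 1)³` when `d ≤ N`. [cite: KumarVolk2022, Thm. 1.4 (proof)] -/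
theorem mul_sq_succ_le_cube {d N : ℕ} (hd : d ≤ N) : d * N ^ 2 + 1 ≤ (N + 1) ^ 3 := by
  have h : (N + 1) ^ 3 = N ^ 3 + 3 * N ^ 2 + 3 * N + 1 := by ring
  rw [h]
  have h1 : d * N ^ 2 ≤ N * N ^ 2 := Nat.mul_le_mul_right _ hd
  have h2 : N * N ^ 2 = N ^ 3 := by ring
  omega

/-- **The count of Thm 5.5**, every `n ≥ 1`: with `K = 3·(⌊n²/300⌋·n)`,
`binom(K + 3n⁴, K) < binom(n³ + n⁴, n³)`. [cite: KumarVolk2022, Thm. 5.5 (proof)] -/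
theorem thm_5_5_count {n : ℕ} (hn : 1 ≤ n) :
    (3 * (n ^ 2 / 300 * n) + 3 * n ^ 4).choose (3 * (n ^ 2 / 300 * n)) <
      (n ^ 3 + n ^ 4).choose (n ^ 3) := by
  have hdiv : n ^ 2 / 300 * 300 ≤ n ^ 2 := Nat.div_mul_le_self _ _
  have hK : 5 * (3 * (n ^ 2 / 300 * n)) < n ^ 3 := by
    have h1 : 300 * (n ^ 2 / 300 * n) ≤ n ^ 2 * n := by nlinarith
    have h2 : n ^ 2 * n = n ^ 3 := by ring
    have h3 : 0 < n ^ 3 := by positivity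
    omega
  rw [Nat.add_comm (n ^ 3)]
  exact choose_lt_choose_of_pow (three_mul_pow_four_succ_le n) hK hn (by ring_nf; exact le_rfl)

/-- **The count of Thm 1.4**, every `n ≥ 1`, `d ≥ 1`: with `K = d·(⌊n^{d-1}/(100d)⌋·n)`,
`binom(K + d·n^{2d}, K) < binom(n^d + n^{2d}, n^d)`. [cite: KumarVolk2022, Thm. 1.4 (proof)] -/
theorem thm_1_4_count {n d : ℕ} (hn : 1 ≤ n) (hd : 1 ≤ d) :
    (d * (n ^ (d - 1) / (100 * d) * n) + d * n ^ (2 * d)).choose (d * (n ^ (d - 1) / (100 * d) * n)) <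
      (n ^ d + n ^ (2 * d)).choose (n ^ d) := by
  set r := n ^ (d - 1) / (100 * d) with hr
  set K := d * (r * n) with hKdef
  have hN : 1 ≤ n ^ d := Nat.one_le_pow _ _ hn
  have hpow : n ^ (2 * d) = n ^ d * n ^ d := by rw [two_mul, pow_add]
  have hdiv : r * (100 * d) ≤ n ^ (d - 1) := Nat.div_mul_le_self _ _
  have hnd : n ^ (d - 1) * n = n ^ d := by
    rw [← pow_succ]; congr 1; omega
  -- `100 K ≤ n^d`
  have hK100 : 100 * K ≤ n ^ d := by
    have : 100 * K = (r * (100 * d)) * n := by rw [hKdef]; ring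
    rw [this, ← hnd]
    exact Nat.mul_le_mul_right _ hdiv
  have hK3 : 3 * K < n ^ d := by omega
  rw [Nat.add_comm (n ^ d)]
  rcases Nat.eq_zero_or_pos K with hK0 | hKpos
  · -- corner `K = 0`: `1 < binom`
    rw [hK0, zero_add, Nat.choose_zero_right]
    calc 1 < (n ^ d + 1) ^ (n ^ d) := Nat.one_lt_pow (by omega) (by omega)
      _ ≤ (n ^ (2 * d) + n ^ d).choose (n ^ d) := succ_pow_le_choose _ _ _ (by rw [hpow])
  · -- `K ≥ 1` forces `n ≥ 2`, hence `d ≤ n^d`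
    have hn2 : 2 ≤ n := by
      by_contra hlt
      have hn1 : n = 1 := by omega
      have hr0 : r = 0 := by
        rw [hr, hn1, one_pow]
        exact Nat.div_eq_of_lt (by omega)
      rw [hKdef, hr0] at hKpos
      simp at hKpos
    have hdN : d ≤ n ^ d :=
      (Nat.lt_two_pow_self).le.trans (Nat.pow_le_pow_left hn2 d)
    refine choose_lt_choose_of_pow (β := n ^ d) (e := 3) ?_ hK3 hN (by rw [hpow])
    rw [hpow, ← sq]
    exact mul_sq_succ_le_cube hdN

end KumarVolk2020

/-- **Kumar–Volk, Thm 5.5 — DISCHARGED**: Lemma 5.4 (`kumarVolk2020_lem_5_4_holds`) + Lemma 2.1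
(`KumarVolk2020.exists_isEquationFor_polyMapImage` at `N = n³`, `D = 3`, `Δ = n⁴`, `K = 3nr`) + the
count `KumarVolk2020.thm_5_5_count`. [cite: KumarVolk2022, Thm. 5.5] -/
theorem kumarVolk2020_thm_5_5_holds : kumarVolk2020_thm_5_5 := by
  intro F _ n hn
  obtain ⟨P, hPdeg, hPim⟩ := kumarVolk2020_lem_5_4_holds F n (n ^ 2 / 300)
  obtain ⟨Q, hQ, hQdeg⟩ := KumarVolk2020.exists_isEquationFor_polyMapImage P
    (D := 3) (Δ := n ^ 4) hPdeg (by
      simp only [Fintype.card_prod, Fintype.card_fin, Fintype.card_fun]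
      have h := KumarVolk2020.thm_5_5_count hn
      convert h using 2)
  exact ⟨Q, hQ.mono hPim, hQdeg⟩

/-- **Kumar–Volk, Thm 1.4 — DISCHARGED** ("we skip the details of the proof" — supplied): Lemma 5.6
(`kumarVolk2020_lem_5_6_holds`) + Lemma 2.1 (`N = n^d`, `D = d`, `Δ = n^{2d}`, `K = dnr`) + the count
`KumarVolk2020.thm_1_4_count`. [cite: KumarVolk2022, Thm. 1.4] -/
theorem kumarVolk2020_thm_1_4_holds : kumarVolk2020_thm_1_4 := by
  intro F _ n d hn hd
  obtain ⟨P, hPdeg, hPim⟩ := kumarVolk2020_lem_5_6_holds F n d (n ^ (d - 1) / (100 * d)) hd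
  obtain ⟨Q, hQ, hQdeg⟩ := KumarVolk2020.exists_isEquationFor_polyMapImage P
    (D := d) (Δ := n ^ (2 * d)) hPdeg (by
      simp only [Fintype.card_prod, Fintype.card_fin, Fintype.card_fun]
      have h := KumarVolk2020.thm_1_4_count hn hd
      convert h using 2)
  exact ⟨Q, hQ.mono hPim, hQdeg⟩

end Literature.Computability.AlgebraicComplexity

end
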